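import Summits.ABC.IUTFork.LDHGenuineStepV
import HarnessLib

/-!
# The fork at [IUTchIII] Corollary 3.12 at a GENUINE input: the SHALLOW regime (the Corollary's inequality HOLDS at
# the input by arithmetic alone) and the DEEP regime (a Szpiro-type necessary condition; the contents decide)
# — skeleton XXVIIc, regimes half

Record-only file (D-0012) of the abc-iut cell (deliverable (a), skeleton seat abc-iut-skel, gen 7); TAKES NO SIDE.
The numerical LOCUS of the dispute at a GENUINE Θ-volume input `I : ThetaVolumeInput F₀ K` (abc-iut-S7/c312-3's
`GenuineLogTheta.lean`: `Cor312Of I` = "`−|log(q)| ≤ −|log(Θ)|`" for the input, [IUTchIII] Cor. 3.12 kurims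
`paper:url-4b091feeb646` p. 173 l. 41 – p. 174 l. 22, with `−|log(Θ)| = negLogThetaNonarch I + ((l+5)/4)·log π` —
sharp (Ind3), full (Ind1)/(Ind2), genuine completions — never asserted), obtained by composing FOUR kernel facts the
cell already holds: abc-iut-S2's free inequality `DHData.free_inequality_input : −deĝ̲_lgp(P_Θ) ≤ negLogThetaNonarch I`
(the bare Θ-region lies in the hull of its own possible images — NO non-identity indeterminacy used; Dupuy–Hilado §4.10–4.12),
abc-iut-S2/c312-d1's squeeze `DHData.gap_le_of_cor312Of : Cor312Of I → deĝ̲_lgp(P_Θ) − deĝ̲(P_q) ≤ δΣ(I) + ((l+5)/4)·log π`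
([IUTchIV] Thm. 1.10 Steps (v)–(viii), `δΣ = DHData.explicitDelta`), c312-d1's `DHData.ndegLgp_thetaPilot_eq :
deĝ̲_lgp(P_Θ) = ((l+1)/24)·deĝ̲(𝔮)` and S7's `ThetaVolumeInput.negAbsLogQ_eq : −|log(q)| = −(1/2l)·deĝ̲(𝔮)` ([IUTchIV]
p. 23 "`|log(q)|` … is equal to `(1/2l)·log(q)`"). With `κ_l := (l+1)/24 − 1/(2l)` and `N := deĝ̲(𝔮)` (the normalised
degree of the `q`-parameter divisor `𝔮 = Σ_{v ∈ 𝕍^bad} ord_v(q_v)·[v]`):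

* **`cor312Of_of_shallow`** — THE SHALLOW REGIME: `κ_l·N ≤ ((l+5)/4)·log π ⟹ Cor312Of I`. The archimedean summand of
  [IUTchIV] Step (vii) (kurims `paper:url-56bcb0f95768` p. 30, "`((l+5)/4)·log(π)`") alone pays for the gap
  `deĝ̲_lgp(P_Θ) − deĝ̲(P_q) = κ_l·N`; the Θ-side is bounded below by the free inequality only. So [IUTchIII] Cor. 3.12's
  inequality is TRUE at every genuine input of small `q`-divisor degree, for reasons orthogonal to the dispute.
* `not_cor312Of_of_deep` / **`cor312Of_regimes`** — THE DEEP REGIME: `Cor312Of I ⟹ κ_l·N ≤ δΣ(I) + ((l+5)/4)·log π`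
  (contrapositively, an input violating this Szpiro-type inequality would REFUTE `Cor312Of` at that input; none is
  claimed to exist).
* `kappa_pos` — `κ_l > 0` for the input's `l ≥ 5` (`l = 5`: shallow means `N ≤ (5/2·log π)/(3/20) ≈ 19.08`; `l = 7`:
  `N ≤ 3·log π/(11/42) ≈ 13.11`), so both regimes are genuine conditions on `N`.

IN BETWEEN the two thresholds the truth value of `Cor312Of I` is the sign of ONE explicit affine function of finitely
many lattice CONTENTS `m(p,j,v⃗)` — abc-iut-c312-3's `ThetaVolumeInput.cor312Of_iff_of_content` (p424014, with
`GenuineLogThetaExactVolume` p422788; skeleton twin `GenuineContent.exists_content_possibleImagesHull`, p424877), each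
content pinned in abc-iut-w5-d082's window (`TensorPacketContentBounds` p421275 / `ForkPacketHullVolumeWindow`; input
form `GenuineContent.neg_thetaMin_le_logμ` / `logμ_le_window`). That middle band is exactly where [IUTchIII] Thm. 3.11
would have to act; nothing here says which sign occurs for the Θ-data of a given curve.

HONEST SCOPE: theorems about the tree's typed numbers at genuine inputs (sharp (Ind3), full (Ind1)/(Ind2), genuine
completions, Mochizuki's container); `Cor312Of` is asserted ONLY under the shallow hypothesis, where it follows from
the free inequality; no side is taken on [IUTchIII] Cor. 3.12, whose content is the claim for ALL initial Θ-data;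
typed ≠ proved. PROOF-ONLY file: no definitions, no `Prop` facts. `HOME/skel/FORK-REAL-MODEL.md` §4/§9, FORK-INDEX row 2.
[cite: Mochizuki2012, IUTchIII Cor. 3.12 p. 173–174] [cite: Mochizuki2012, IUTchIV Thm. 1.10 Step (vii) p. 30]
[cite: DupuyHilado2025, §1 (1.1), §4.10, §4.11, §4.12] [claim: Mochizuki2012, status: disputed]
-/

noncomputable section

open Literature.IUT.LogVolume NumberField IsDedekindDomain

namespace Summit.ABC.IUTFork.GenuineContent

section Regimes

variable {F₀ : Type} [Field F₀] [NumberField F₀] {K : Type} [Field K] [NumberField K] [Algebra F₀ K]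
variable (I : ThetaVolumeInput F₀ K)

/-! ## The two regimes: where Cor. 3.12 at a genuine input is decided by arithmetic alone, and where by the contents -/

/-- **THE SHALLOW REGIME — [IUTchIII] Cor. 3.12 HOLDS at every genuine input with small `q`-divisor degree.**
If `((l+1)/24 − 1/(2l))·deĝ̲(𝔮) ≤ ((l+5)/4)·log π` — i.e. the archimedean summand of `−|log(Θ|` ([IUTchIV] Step
(vii)) alone pays for the gap `deĝ̲_lgp(P_Θ) − deĝ̲(P_q) = ((l+1)/24 − 1/(2l))·deĝ̲(𝔮)` — then `Cor312Of I`, by the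
free inequality `−deĝ̲_lgp(P_Θ) ≤ negLogThetaNonarch I` (the bare Θ-region lies in the hull of its possible images:
NO non-identity indeterminacy is used). A KERNEL THEOREM about the tree's typed numbers at genuine inputs; it takes no side on the
disputed inference of Cor. 3.12 (whose content is the claim for ALL initial Θ-data, in the deep regime below).
[cite: Mochizuki2012, IUTchIII Cor. 3.12 p. 173–174] [cite: Mochizuki2012, IUTchIV Thm. 1.10 Step (vii) p. 30]
[cite: DupuyHilado2025, §4.10–4.12] -/
theorem cor312Of_of_shallow
    (h : (((I.X.l : ℝ) + 1) / 24 - 1 / (2 * (I.X.l : ℝ))) * FinDivisor.ndeg F₀ I.X.qDivisor ≤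
      ThetaVolumeInput.archLogTheta I.l) :
    I.Cor312Of := by
  have hfree := DHData.free_inequality_input I
  rw [DHData.ndegLgp_thetaPilot_eq] at hfree
  have hq := I.negAbsLogQ_eq
  unfold ThetaVolumeInput.Cor312Of ThetaVolumeInput.negLogTheta
  rw [hq]
  have hsplit : (((I.X.l : ℝ) + 1) / 24 - 1 / (2 * (I.X.l : ℝ))) * FinDivisor.ndeg F₀ I.X.qDivisor =
      ((I.X.l : ℝ) + 1) / 24 * FinDivisor.ndeg F₀ I.X.qDivisor
        - 1 / (2 * (I.X.l : ℝ)) * FinDivisor.ndeg F₀ I.X.qDivisor := sub_mul _ _ _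
  change -(1 / (2 * (I.X.l : ℝ))) * FinDivisor.ndeg F₀ I.X.qDivisor ≤
    I.negLogThetaNonarch + ThetaVolumeInput.archLogTheta I.X.l
  change _ ≤ ThetaVolumeInput.archLogTheta I.X.l at h
  linarith

/-- **THE DEEP REGIME — the necessary condition** (abc-iut-S2/c312-d1's squeeze `gap_le_of_cor312Of`, same
currency): `Cor312Of I` forces `((l+1)/24 − 1/(2l))·deĝ̲(𝔮) ≤ δΣ(I) + ((l+5)/4)·log π` with c312-d1's explicit Step (v)
discrepancy `δΣ(I) = explicitDelta I`; contrapositively an input violating it would REFUTE Cor. 3.12 at that input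
(none is claimed to exist: in the sharp real model this is a Szpiro-type inequality for the curve).
[cite: Mochizuki2012, IUTchIV Thm. 1.10 Steps (v)–(viii) p. 27–30] [claim: Mochizuki2012, status: disputed] -/
theorem not_cor312Of_of_deep
    (h : DHData.explicitDelta I + ThetaVolumeInput.archLogTheta I.l <
      (((I.X.l : ℝ) + 1) / 24 - 1 / (2 * (I.X.l : ℝ))) * FinDivisor.ndeg F₀ I.X.qDivisor) :
    ¬ I.Cor312Of := by
  intro hc
  have hgap := DHData.gap_le_of_cor312Of I hc
  rw [DHData.ndegLgp_thetaPilot_eq] at hgap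
  have hq := I.negAbsLogQ_eq
  unfold ThetaVolumeInput.negAbsLogQ at hq
  have hsplit : (((I.X.l : ℝ) + 1) / 24 - 1 / (2 * (I.X.l : ℝ))) * FinDivisor.ndeg F₀ I.X.qDivisor =
      ((I.X.l : ℝ) + 1) / 24 * FinDivisor.ndeg F₀ I.X.qDivisor
        - 1 / (2 * (I.X.l : ℝ)) * FinDivisor.ndeg F₀ I.X.qDivisor := sub_mul _ _ _
  change -FinDivisor.ndeg F₀ I.X.qPilot = -(1 / (2 * (I.X.l : ℝ))) * FinDivisor.ndeg F₀ I.X.qDivisor at hq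
  change DHData.explicitDelta I + ThetaVolumeInput.archLogTheta I.X.l < _ at h
  change _ ≤ DHData.explicitDelta I + ThetaVolumeInput.archLogTheta I.X.l at hgap
  linarith

/-- **THE TWO REGIMES TOGETHER** (the numerical locus of the dispute at genuine inputs): with
`κ_l := (l+1)/24 − 1/(2l) > 0` and `N := deĝ̲(𝔮)`, `κ_l·N ≤ ((l+5)/4)·log π ⟹ Cor312Of I` and
`Cor312Of I ⟹ κ_l·N ≤ δΣ(I) + ((l+5)/4)·log π`; strictly between the two thresholds the truth value of `Cor312Of I` is
the sign of one explicit affine function of the contents `m(p,j,v⃗)` (abc-iut-c312-3's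
`ThetaVolumeInput.cor312Of_iff_of_content`), each pinned in its window (abc-iut-w5-d082's `TensorPacketContentBounds`;
input form `GenuineContent.logμ_le_window`). Nothing here says which sign occurs for the Θ-data of a given curve;
typed ≠ proved; no side taken. [claim: Mochizuki2012, status: disputed] -/
theorem cor312Of_regimes :
    ((((I.X.l : ℝ) + 1) / 24 - 1 / (2 * (I.X.l : ℝ))) * FinDivisor.ndeg F₀ I.X.qDivisor ≤
        ThetaVolumeInput.archLogTheta I.l → I.Cor312Of) ∧
      (I.Cor312Of → (((I.X.l : ℝ) + 1) / 24 - 1 / (2 * (I.X.l : ℝ))) * FinDivisor.ndeg F₀ I.X.qDivisor ≤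
        DHData.explicitDelta I + ThetaVolumeInput.archLogTheta I.l) :=
  ⟨cor312Of_of_shallow I, fun hc => not_lt.mp fun h => not_cor312Of_of_deep I h hc⟩

/-- `κ_l = (l+1)/24 − 1/(2l) > 0` for the input's `l ≥ 5`: the shallow regime is a genuine condition on `deĝ̲(𝔮)`
(for `l = 5`: `deĝ̲(𝔮) ≤ (5/2·log π)/(3/20) ≈ 19.08`; for `l = 7`: `≤ 3·log π/(11/42) ≈ 13.11`).
[cite: Mochizuki2012, IUTchI Def. 3.1 (c) p. 61] -/
theorem kappa_pos : 0 < ((I.X.l : ℝ) + 1) / 24 - 1 / (2 * (I.X.l : ℝ)) := by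
  have h5 : (5 : ℝ) ≤ I.X.l := by exact_mod_cast I.X.five_le_l
  have hl : (0 : ℝ) < I.X.l := by linarith
  rw [div_sub_div _ _ (by norm_num : (24 : ℝ) ≠ 0) (by positivity : (2 * (I.X.l : ℝ)) ≠ 0)]
  apply div_pos
  · nlinarith
  · positivity

end Regimes

end Summit.ABC.IUTFork.GenuineContent

end
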